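import Literature.Algebra.Homology.PolyInfiniteCyclicCohomology
import Mathlib.LinearAlgebra.FiniteDimensional.Lemmas
import HarnessLib

/-!
# Betti number bounds for poly-(infinite cyclic) groups: `dim Hⁿ(Γ, A) ≤ dim A · (d choose n)`

Topic `Algebra/Homology`; namespace `Literature.Algebra.Homology`.  Theorems only; Mathlib +
`InfiniteCyclicQuotientCohomology` (the Wang sequence `Hⁿ(H, A) → Hⁿ⁺¹(G, A) → Hⁿ⁺¹(H, A)` of an
infinite cyclic quotient) + `PolyInfiniteCyclicCohomology` (finiteness along a chain) +
`GroupCohomologyFiniteIndexModuleFinite` (transport along `≃*`).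

* `finrank_mid_le_of_exact` — for `M₁ → M₂ → M₃` exact at `M₂`, `dim M₂ ≤ dim M₁ + dim M₃`;
* `finrank_groupCohomology_succ_le` — **Wang inequality**: if `H ⊴ G` with `G / H` infinite cyclic,
  `dim Hⁿ⁺¹(G, A) ≤ dim Hⁿ(H, A) + dim Hⁿ⁺¹(H, A)`;
* `finrank_groupCohomology_le_of_chain` — for a chain `⊥ = c 0 ≤ c 1 ≤ ⋯ ≤ c d` of subgroups
  with infinite cyclic successive quotients (a poly-ℤ group of length `d`, e.g. `ℤ^d`) and a
  finite-dimensional representation `A` of `c d` over a field: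
  **`dim Hⁿ(c d, A) ≤ dim A · (d choose n)`** (Pascal's rule along the Wang inequalities); in
  particular `dim Hⁿ(ℤ^d, k) ≤ (d choose n)`, the upper bound in `H•(ℤ^d, k) = Λ•(k^d)`
  [Brown1982CohomologyGroups, V §6, VIII §2].

## References

* K. S. Brown, *Cohomology of Groups*, GTM 87 (1982), III §6–§7, V §6, VIII §2
  [Brown1982CohomologyGroups].
-/

noncomputable section

open CategoryTheory CategoryTheory.Limits groupCohomology

universe u

namespace Literature.Algebra.Homology

variable {k : Type u} [Field k]

/-! ### Linear algebra -/

/-- `dim M₂ ≤ dim M₁ + dim M₃` for `M₁ → M₂ → M₃` exact at `M₂`. [folklore] -/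
theorem finrank_mid_le_of_exact {M₁ M₂ M₃ : Type*} [AddCommGroup M₁] [Module k M₁] [AddCommGroup M₂]
    [Module k M₂] [AddCommGroup M₃] [Module k M₃] [FiniteDimensional k M₁] [FiniteDimensional k M₂]
    [FiniteDimensional k M₃] (f : M₁ →ₗ[k] M₂) (g : M₂ →ₗ[k] M₃) (hfg : LinearMap.range f = LinearMap.ker g) :
    Module.finrank k M₂ ≤ Module.finrank k M₁ + Module.finrank k M₃ := by
  have h1 := LinearMap.finrank_range_add_finrank_ker g
  have h2 : Module.finrank k (LinearMap.ker g) ≤ Module.finrank k M₁ := by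
    rw [← hfg]
    exact LinearMap.finrank_range_le f
  have h3 : Module.finrank k (LinearMap.range g) ≤ Module.finrank k M₃ := Submodule.finrank_le _
  omega

/-- `dim H⁰(G, A) ≤ dim A` (the invariants). [folklore] -/
theorem finrank_groupCohomology_zero_le {G : Type u} [Group G] (A : Rep k G) [FiniteDimensional k A] :
    Module.finrank k (groupCohomology A 0) ≤ Module.finrank k A := by
  rw [(groupCohomology.H0Iso A).toLinearEquiv.finrank_eq]
  exact Submodule.finrank_le _

/-- Transport of `dim Hⁿ` along `e : G ≃* H`: `dim Hⁿ(H, A) = dim Hⁿ(G, Res_e A)`. [folklore] -/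
theorem finrank_groupCohomology_of_mulEquiv {G H : Type u} [Group G] [Group H] (e : G ≃* H) (A : Rep k H)
    (n : ℕ) : Module.finrank k (groupCohomology A n) = Module.finrank k (groupCohomology (Rep.res (e : G →* H) A) n) :=
  ((groupCohomology.mapIso (A := A) (B := Rep.res (e : G →* H) A) e (LinearEquiv.refl k _) (fun _ => rfl)
    n).toLinearEquiv.finrank_eq).symm

/-! ### The Wang inequality -/

/-- **Wang inequality**: for `H ⊴ G` with `G / H` infinite cyclic generated by `tH` and
`Hⁿ(H, A)`, `Hⁿ⁺¹(H, A)` finite-dimensional, `dim Hⁿ⁺¹(G, A) ≤ dim Hⁿ(H, A) + dim Hⁿ⁺¹(H, A)`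
(exactness of `Hⁿ(H, A) → Hⁿ⁺¹(G, A) → Hⁿ⁺¹(H, A)`). [cite: Brown1982CohomologyGroups, III §6–§7] -/
theorem finrank_groupCohomology_succ_le {G : Type u} [Group G] (H : Subgroup G) [H.Normal] (t : G)
    (hgen : ∀ g : G, ∃ (h : H) (n : ℤ), g = (h : G) * t ^ n) (hfree : ∀ n : ℤ, t ^ n ∈ H → n = 0)
    (A : Rep k G) (n : ℕ) [FiniteDimensional k (groupCohomology (Rep.res H.subtype A) n)]
    [FiniteDimensional k (groupCohomology (Rep.res H.subtype A) (n + 1))] :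
    Module.finrank k (groupCohomology A (n + 1)) ≤
      Module.finrank k (groupCohomology (Rep.res H.subtype A) n) +
        Module.finrank k (groupCohomology (Rep.res H.subtype A) (n + 1)) := by
  have hX := shortExact_shiftComplex H A t hgen hfree
  have hex := groupCohomology.mapShortComplex₁_exact hX (i := n) (j := n + 1) rfl
  let e₁ := (groupCohomology.coindIso (Rep.res H.subtype A) n).toLinearEquiv
  let e₂ := (groupCohomology.coindIso (Rep.res H.subtype A) (n + 1)).toLinearEquiv
  have inst₁ : FiniteDimensional k (groupCohomology (coindRes H A) n) := Module.Finite.equiv e₁.symm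
  have inst₃ : FiniteDimensional k (groupCohomology (coindRes H A) (n + 1)) := Module.Finite.equiv e₂.symm
  have inst₂ : FiniteDimensional k (groupCohomology A (n + 1)) :=
    moduleFinite_groupCohomology_succ H A t hgen hfree n ‹_› ‹_›
  have h := @finrank_mid_le_of_exact k _ _ _ _ _ _ _ _ _ _ inst₁ inst₂ inst₃
    (groupCohomology.mapShortComplex₁ hX (i := n) (j := n + 1) rfl).f.hom
    (groupCohomology.mapShortComplex₁ hX (i := n) (j := n + 1) rfl).g.hom hex.moduleCat_range_eq_ker
  calc Module.finrank k (groupCohomology A (n + 1))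
      ≤ Module.finrank k (groupCohomology (coindRes H A) n) + Module.finrank k (groupCohomology (coindRes H A) (n + 1)) := h
    _ = Module.finrank k (groupCohomology (Rep.res H.subtype A) n) +
        Module.finrank k (groupCohomology (Rep.res H.subtype A) (n + 1)) := by rw [e₁.finrank_eq, e₂.finrank_eq]

/-! ### Pascal's rule along a poly-ℤ chain -/

/-- **`dim Hⁿ(c d, A) ≤ dim A · (d choose n)` for a poly-ℤ chain of length `d`.**  Let
`c : ℕ → Subgroup G` with `c 0 = ⊥` and, for every `i < d`, `c i ≤ c (i + 1)`, `c i` normal in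
`c (i + 1)` with infinite cyclic quotient generated by some `t ∈ c (i + 1)`.  Then for every
finite-dimensional representation `A` of `c d` and every `n`,
`dim Hⁿ(c d, A) ≤ dim A · (d choose n)`. [cite: Brown1982CohomologyGroups, V §6 and VIII §2] -/
theorem finrank_groupCohomology_le_of_chain {G : Type u} [Group G] (c : ℕ → Subgroup G) (h0 : c 0 = ⊥) :
    ∀ (d : ℕ),
      (∀ i < d, c i ≤ c (i + 1)) →
      (∀ i < d, ((c i).subgroupOf (c (i + 1))).Normal) →
      (∀ i < d, ∃ t ∈ c (i + 1),
        (∀ g ∈ c (i + 1), ∃ h ∈ c i, ∃ m : ℤ, g = h * t ^ m) ∧ (∀ m : ℤ, t ^ m ∈ c i → m = 0)) →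
      ∀ (A : Rep k (c d)), FiniteDimensional k A → ∀ n,
        Module.finrank k (groupCohomology A n) ≤ Module.finrank k A * Nat.choose d n := by
  -- (FC) and the subsingleton base, for finiteness of all the cohomology along the chain
  have hsub : Subsingleton (c 0) := by
    rw [h0]
    exact ⟨fun x y => Subtype.ext ((Subgroup.mem_bot.1 x.2).trans (Subgroup.mem_bot.1 y.2).symm)⟩
  have hFC0 : ∀ (B : Rep k (c 0)), Module.Finite k B → ∀ n, Module.Finite k (groupCohomology B n) :=
    fun B hB n => by
      haveI := hB
      exact moduleFinite_groupCohomology_of_subsingleton B n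
  intro d
  induction d with
  | zero =>
    intro _ _ _ A hA n
    haveI := hA
    cases n with
    | zero =>
      rw [Nat.choose_zero_right, mul_one]
      exact finrank_groupCohomology_zero_le A
    | succ n =>
      haveI := ModuleCat.subsingleton_of_isZero (isZero_groupCohomology_succ_of_subsingleton A n)
      rw [Module.finrank_zero_of_subsingleton]
      exact Nat.zero_le _
  | succ m ih =>
    intro hle hnorm hcyc A hA n
    haveI := hA
    have ih' := ih (fun i hi => hle i (Nat.lt_succ_of_lt hi)) (fun i hi => hnorm i (Nat.lt_succ_of_lt hi))
      (fun i hi => hcyc i (Nat.lt_succ_of_lt hi))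
    have hFCm := moduleFinite_groupCohomology_of_chain c hFC0 m (fun i hi => hle i (Nat.lt_succ_of_lt hi))
      (fun i hi => hnorm i (Nat.lt_succ_of_lt hi)) (fun i hi => hcyc i (Nat.lt_succ_of_lt hi))
    cases n with
    | zero =>
      rw [Nat.choose_zero_right, mul_one]
      exact finrank_groupCohomology_zero_le A
    | succ n =>
      have hle' : c m ≤ c (m + 1) := hle m (Nat.lt_succ_self m)
      haveI hN : ((c m).subgroupOf (c (m + 1))).Normal := hnorm m (Nat.lt_succ_self m)
      obtain ⟨t, ht, hgen, hfree⟩ := hcyc m (Nat.lt_succ_self m)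
      set H := (c m).subgroupOf (c (m + 1)) with hH
      let e : H ≃* c m := Subgroup.subgroupOfEquivOfLe hle'
      -- the restriction to `H ≃* c m` and the induction hypothesis
      let B : Rep k (c m) := Rep.res (e.symm : c m →* H) (Rep.res H.subtype A)
      have hBfin : FiniteDimensional k B := hA
      have hBrank : ∀ j, Module.finrank k (groupCohomology (Rep.res H.subtype A) j) ≤
          Module.finrank k A * Nat.choose m j := fun j => by
        rw [finrank_groupCohomology_of_mulEquiv e.symm (Rep.res H.subtype A) j]
        exact ih' B hBfin j
      haveI : ∀ j, FiniteDimensional k (groupCohomology (Rep.res H.subtype A) j) := fun j =>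
        moduleFinite_groupCohomology_of_mulEquiv e.symm hFCm (Rep.res H.subtype A) j
      have hgen' : ∀ g : c (m + 1), ∃ (h : H) (n : ℤ), g = (h : c (m + 1)) * (⟨t, ht⟩ : c (m + 1)) ^ n := by
        intro g
        obtain ⟨h, hh, n, hg⟩ := hgen g g.2
        refine ⟨⟨⟨h, hle' hh⟩, Subgroup.mem_subgroupOf.2 hh⟩, n, Subtype.ext ?_⟩
        rw [Subgroup.coe_mul, SubgroupClass.coe_zpow]
        exact hg
      have hfree' : ∀ n : ℤ, (⟨t, ht⟩ : c (m + 1)) ^ n ∈ H → n = 0 := fun n hn =>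
        hfree n (by simpa [hH, Subgroup.mem_subgroupOf] using hn)
      calc Module.finrank k (groupCohomology A (n + 1))
          ≤ Module.finrank k (groupCohomology (Rep.res H.subtype A) n) +
              Module.finrank k (groupCohomology (Rep.res H.subtype A) (n + 1)) :=
            finrank_groupCohomology_succ_le H ⟨t, ht⟩ hgen' hfree' A n
        _ ≤ Module.finrank k A * Nat.choose m n + Module.finrank k A * Nat.choose m (n + 1) :=
            Nat.add_le_add (hBrank n) (hBrank (n + 1))
        _ = Module.finrank k A * Nat.choose (m + 1) (n + 1) := by
            rw [Nat.choose_succ_succ, mul_add]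

end Literature.Algebra.Homology

end
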